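/-
Copyright: lit-balaban Phase-2 proof seat p29 (gen 31).  Statement-level skeleton of a published paper; no proof claims beyond what the
kernel checks below.
-/
import Literature.MathematicalPhysics.QuantumFieldTheory.BalabanImbrieJaffe1984to88.BIJ88LocDeriv230SmallFieldOpTorus
import Literature.MathematicalPhysics.QuantumFieldTheory.BalabanImbrieJaffe1984to88.BIJ88LocDerivHolder230SmallPlaquetteTorus
import Literature.MathematicalPhysics.QuantumFieldTheory.BalabanImbrieJaffe1984to88.BIJ88NeumannPropagatorActualBackground

/-!
# `BalabanImbrieJaffe1984to88.BIJ88Loc230ActualBackground` — T. Bałaban, J. Imbrie, A. Jaffe, *Effective action and cluster properties of the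
abelian Higgs model*, Commun. Math. Phys. **114** (1988) 257–315 [BalabanImbrieJaffe1988], Sect. 2 p. 263 [PDF 7], (2.30) and the sentence
after (2.33) — **THE COVARIANT-DERIVATIVE MEMBER, THE HÖLDER-`θ′ ≤ 1` MEMBER AND THE HÖLDER-`(1 + θ)` MEMBER OF (2.30) FOR `G_{k,loc}(u_k)`,
PRINTED TORUS DATA OF RECORD, AT THE ACTUAL BACKGROUND `u_k` OF THE INDUCTION** ([BalabanImbrieJaffe1985] (4.5.4); p. 326: *"The
propagators arising from Δ_k(u_k), under the restriction (7.3.1) on the gauge field, also satisfy the regularity and decay estimates of [7]"*):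
gen 29/30's hypothesis-free PLAQUETTE-ONLY members `BIJ88LocDeriv230SmallFieldOpTorus.{deriv230_smallPlaquette_op_cwt,
holder230_smallPlaquette_op_of_lipschitz, exists_contour_holder230_smallPlaquette_op_cwt}` and
`BIJ88LocDerivHolder230SmallPlaquetteTorus.{derivHolder230_smallPlaquette_of_smooth, derivHolder230_smallPlaquette_zetaPi}` at the field
`u_k = actualBgU1 hd2 k e v` (p30's (4.5.4) background of record) under the PRINTED (7.3.1) `‖v(∂q) − 1‖ ≤ e𝓅(e)` on all unit plaquettes and
ONE threshold `e𝓅(e) ≤ 1/(23D²K)`, by p34 gen 19's passage `BIJ88NeumannPropagatorActualBackground.smallPlaquette_actualBg` (plaquette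
smallness `θ_p = K·e𝓅(e)/(L^k)²`, `2D³(L^{2k}θ_p)² ≤ 1`, the `T`-slot at `T = (D−1)(L^k−1)θ_p` with its `(T, ½)` condition; `K = K(D, L) ≥ 1`
from p33's all-tori constant) — the (2.30) companion of gen 30's `BIJ88Loc231ActualBackground` (the (2.31) members at `u_k`).

statement-level skeleton of published theorems with citation tags; proofs where landed; nothing here is a claim about the Yang–Mills mass gap

PDF held: `paper:balaban1988-cmp114-bij-abelian-higgs-effective-action` (journal page = PDF page + 256); p. 263 [PDF 7] re-read this session on
the materialised text layer.

CITATION HEADER (lean-in-tree rule).  Part of the lit-balaban TYPED SKELETON (HOME `run/shared/lean/pub/lit-balaban/`), PHASE-2 proof seat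
p29 gen 31 (unit `lit-balaban-p29-g31`; free-target protocol G.5-34(d), TAKING #2 line HOME/STATUS.md 2026-08-23; disjoint from r18 gen 26's
`BIJ88DeltaLocActualBackgroundCwt` — the OPERATOR/kernel members of (2.30)/(2.31)/(2.35)–(2.41) at `u_k` — and from p34/p30/p27's [6]-input
files at `u_k`).  Rows **C2.Eq2.30** / **C2.Claim@263** of `HOME/lit-balaban-r18/ROWS-C2.md` (owner r18; heads unchanged — LOCATED members
at `u_k`; r18's `C2S14-CLOSURE.md` §6 row «actual background u_k», last column) and **C1.Eq7.3.1-7.3.2** / **C1.Eq4.5.4** (owner r15: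
located consequence).  Kind: theorems only (no definition, no `Prop`-valued fact; p29/p30/p34 declarations BY NAME, nothing restated).

THE PRINTED TEXT (p. 263, verbatim, print order).  *"A straightforward application of the random walk expansion of [6] shows that
|(G_{k,loc}(u)f)(x)| ≦ ce^{−c dist(suppt f, x)}‖f‖_∞, (2.30) … We assume that u is smooth in the □_α's entering the sum in (2.27) … Bounds
analogous to (2.30), (2.31) hold for covariant derivatives and Hölder derivatives of G_{k,loc}(u) of order less than two."*
[BalabanImbrieJaffe1985] p. 326: *"(7.3.1) |v(∂p) − 1| < e𝓅(e) … The propagators arising from Δ_k(u_k), under the restriction (7.3.1) on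
the gauge field, also satisfy the regularity and decay estimates of [7]."*

WHAT IS PROVED (theorems only; 0 `sorry`; standard axioms).  For `1 ≤ d`, `d + 1 ≤ 3`, `L` odd `> 1`, `a > 0`, `pexp` (and `0 ≤ θ < 1`,
moduli `K₁, K₂ ≥ 0` where displayed): THERE ARE `K ≥ 1`, `t₀, C > 0` such that on every torus (`P.d = d+1`, `P.L = L`), at every
`1 ≤ k ≤ K_P` with `2(L^k−1) + 4 < |T^{(0)}|`, for every `0 < e ≤ 1` with `e(1 + log e⁻¹)^{pexp} ≤ 1/(23(d+1)²K)`, every unit-lattice `U(1)`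
field `v` with `‖v(∂q) − 1‖ ≤ e(1 + log e⁻¹)^{pexp}` on all plaquettes, the printed data (`cubeFam`/`lamFam`, no-wrap box `Ω₀` with torus gap
`≥ R`, radii as in the providers), with `u_k = actualBgU1 hd2 k e v`:
* §1 **`deriv230_actualBg`** — `‖(D_{u_k}G_{k,loc}(u_k)f)(x,μ)‖ ≤ (L^kε)·C·m·(1 + L^k((R₀−R₁)⁻¹ + s⁻¹))·e^{−t₀D/L^k}·F` at every bond with
  both ends in `Ω₀` at chart depth `≥ R₀` (p13's cut-off of record);
* §2 **`holder230_actualBg_of_lipschitz`** (generic Lipschitz cut-off, along admissible contours), **`exists_contour_holder230_actualBg`**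
  (p13's cut-off, [6]'s shortest-contour ∃-form) — the Hölder-`θ′ ≤ 1` member `(L^k/|x₁−x₂|_T)^{θ′}·‖u_k(Γ)(G_{k,loc}f)(x₂) − (G_{k,loc}f)(x₁)‖
  ≤ (L^kε)²·C·m·(1 + L^k((R₀−R₁)⁻¹ + s⁻¹))·e^{−t₀D/L^k}·F`;
* §3 **`derivHolder230_actualBg_of_smooth`** (generic smooth cut-off with moduli `K₁`, `K₂`), **`derivHolder230_actualBg_zetaPi`** (r18's
  `ζ^Π(R₁,R₀)`) — the Hölder-`(1+θ)` member `(L^k/|x₁−x₂|_T)^θ·‖U(Γ_{x₁,x₂})(D_{u_k}G_{k,loc}f)(x₂,μ) − (D_{u_k}G_{k,loc}f)(x₁,μ)‖ ≤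
  (L^kε)·C·m·(1 + L^k((R₀−R₁)⁻¹ + s⁻¹))²·e^{−t₀D/L^k}·F`, `U(Γ)` = p30's staircase `stairHol`.
HONEST SCOPE / DIVERGENCE.  (i) As the providers (dimensions `2 ≤ d + 1 ≤ 3`, `L` odd `≥ 3`, deep bonds/pairs in the reference box, method
divergence: block-centred gauges chosen cube by cube, constants existential in `(d, L, a, …)` and p33's `K`, not evaluated).  (ii) `u_k =
actualBgU1 hd2 k e v` is the tree's (4.5.4) background object of p30/p34's lineage (centred block conventions); its relation to every printed
convention is discussed in their files, not here.  (iii) *"e sufficiently small"* = the ONE explicit threshold `e𝓅(e) ≤ 1/(23D²K)`.  (iv) The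
value/operator member of (2.30) at `u_k` is r18 gen 26's lane (`BIJ88DeltaLocActualBackgroundCwt`), not here.  Imports: gen 29/30
`BIJ88LocDeriv230SmallFieldOpTorus`, `BIJ88LocDerivHolder230SmallPlaquetteTorus`, p34 gen 19 `BIJ88NeumannPropagatorActualBackground`.
Literature + Mathlib only.  Unit `lit-balaban-p29` (literature-prover-lit-balaban-p29-g31-0), 2026-08-23.  NOT summit progress.
-/

open scoped BigOperators Matrix ComplexConjugate
open Finset Matrix

namespace Literature.MathematicalPhysics.QuantumFieldTheory.BalabanImbrieJaffe1984to88.BIJ88Loc230ActualBackground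

open Literature.MathematicalPhysics.QuantumFieldTheory.Balaban1983to89
open BIJ88Sect3Statements (U1 toC cfg covD)
open BIJ85BlockAveragesTorus BIJ85BlockAveragesTorusK
open BIJ88DeltaLoc234Torus (gLocT)
open BIJ88NeumannPropagatorFlatDecayCube (cubeT boxCoord)
open BIJ88Cutoffs21 (cutoff)
open BIJ88LocWeights227Torus
open BIJ85Sect1Model (U1Field plaq)
open BIJ85Eq454PlaqResidual (actualBgU1)
open BIJ85ScalarPropagatorHolderDecay (stairHol)
open BIJ88HkLocHolderTorus (zetaPi)
open BIJ88NeumannPropagatorActualBackground (smallPlaquette_actualBg)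
open BIJ88LocDeriv230SmallFieldOpTorus (deriv230_smallPlaquette_op_cwt holder230_smallPlaquette_op_of_lipschitz
  exists_contour_holder230_smallPlaquette_op_cwt)
open BIJ88LocDerivHolder230SmallPlaquetteTorus (derivHolder230_smallPlaquette_of_smooth derivHolder230_smallPlaquette_zetaPi)
open T4TreeGaugeFixing (Joins)
open T4TreeGaugeTransform (chainHol)

noncomputable section

variable {d : ℕ} {P : Params}

/-! ## §1 The covariant-derivative member of (2.30) at the actual background -/

set_option maxHeartbeats 400000 in
/-- **THE COVARIANT-DERIVATIVE MEMBER OF (2.30) FOR `G_{k,loc}(u_k)` AT THE ACTUAL BACKGROUND `u_k` UNDER (7.3.1)** (p. 263 (2.30) + *"Bounds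
analogous to (2.30), (2.31) hold for covariant derivatives …"*; [BalabanImbrieJaffe1985] (4.5.4), (7.3.1)): `deriv230_smallPlaquette_op_cwt` at
`u = actualBgU1 hd2 k e v`, `θ_p = K·e𝓅(e)/(L^k)²`, `T = (D−1)(L^k−1)θ_p` (p34's `smallPlaquette_actualBg`).
[cite: BalabanImbrieJaffe1988, (2.30) p.263] [cite: BalabanImbrieJaffe1985, (7.3.1) p.326, (4.5.4) p.313] -/
theorem deriv230_actualBg (d L : ℕ) (hd1 : 1 ≤ d) (hd3 : d + 1 ≤ 3) (hL : Odd L ∧ 1 < L) {a : ℝ} (ha : 0 < a) (pexp : ℝ) :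
    ∃ K t₀ C : ℝ, 1 ≤ K ∧ 0 < t₀ ∧ 0 < C ∧ ∀ (P : Params) (hPd : P.d = d + 1), P.L = L →
      ∀ (hd2 : 2 ≤ P.d) (k : ℕ), 1 ≤ k → k ≤ P.K → 2 * (P.L ^ k - 1) + 4 < P.sitesPerDir 0 →
      ∀ (e : ℝ), 0 < e → e ≤ 1 → e * (1 + Real.log e⁻¹) ^ pexp ≤ 1 / (23 * (P.d : ℝ) ^ 2 * K) →
      ∀ (v : U1Field P k), (∀ q : Balaban1983to89.Plaq P k, ‖((plaq v q : Circle) : ℂ) - 1‖ ≤ e * (1 + Real.log e⁻¹) ^ pexp) →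
      ∀ (c M0 : Fin (d + 1) → ℕ), (∀ i, 1 ≤ M0 i) →
        (∀ i, c i * P.L ^ k + P.L ^ k * M0 i ≤ P.sitesPerDir 0) → (∀ i, P.L ^ k * M0 i < P.sitesPerDir 0) →
      ∀ (s W : ℕ), 1 ≤ s → ∀ (R R₀ R₁ : ℝ), (P.L : ℝ) ^ k + 1 ≤ R → 0 ≤ R₁ → R₁ < R₀ → (P.L : ℝ) ^ k ≤ R₀ →
        2 * (s : ℝ) / 3 + R₀ / 2 + R ≤ W → (∀ i, ((P.L ^ k * M0 i : ℕ) : ℝ) + R ≤ P.sitesPerDir 0) →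
      ∀ (x : Balaban1983to89.Site P 0) (μ : Fin P.d),
        x ∈ (cubeT hPd (P.L ^ k) c fun i => P.L ^ k * M0 i) →
        (∀ i, R₀ ≤ (boxCoord hPd (P.L ^ k) c x i : ℝ) ∧ (boxCoord hPd (P.L ^ k) c x i : ℝ) + R₀ ≤ (P.L ^ k * M0 i : ℕ) - 1) →
        x.shift μ ∈ (cubeT hPd (P.L ^ k) c fun i => P.L ^ k * M0 i) →
        (∀ i, R₀ ≤ (boxCoord hPd (P.L ^ k) c (x.shift μ) i : ℝ) ∧
          (boxCoord hPd (P.L ^ k) c (x.shift μ) i : ℝ) + R₀ ≤ (P.L ^ k * M0 i : ℕ) - 1) →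
      ∀ (f : Balaban1983to89.Site P 0 → ℂ) (F D : ℝ), (∀ y, ‖f y‖ ≤ F) → 0 ≤ D → (∀ y, f y ≠ 0 → D ≤ B5Ineq137Torus.T P 0 x y) →
        ‖covD P.eps⁻¹ (cfg (actualBgU1 hd2 k e v))
            (gLocT (B1RG242Torus.α P a k * (P.L : ℝ) ^ (k * P.d)) P.eps⁻¹ (actualBgU1 hd2 k e v) k (cubeFam hPd (P.L ^ k) c M0 s W)
              (lamFam hPd (P.L ^ k) c M0 s) (cutoff R₁ R₀ (B5Ineq137Torus.T P 0)) *ᵥ f) ⟨x, μ⟩‖ ≤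
          P.spacing k * (C * (⌊(((P.L : ℝ) ^ k) - 1 + R₀) / s⌋₊ + 3) ^ (d + 1) *
            (1 + (P.L : ℝ) ^ k * ((R₀ - R₁)⁻¹ + (s : ℝ)⁻¹)) * Real.exp (-(t₀ * (((P.L : ℝ) ^ k)⁻¹ * D))) * F) := by
  obtain ⟨K, hK1, HK⟩ := smallPlaquette_actualBg (d := d + 1) (L := L) (by omega) pexp
  obtain ⟨t₀, C, ht₀, hC, G⟩ := deriv230_smallPlaquette_op_cwt d L hd1 hd3 hL ha
  refine ⟨K, t₀, C, hK1, ht₀, hC, ?_⟩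
  intro P hPd hPL hd2 k hk1 hkK hbig e he he1 hsm v hv c M0 hM0 hfit0 hN0 s W hs R R₀ R₁ hR hR₁ hR10 hLR₀ hW hgap x μ hx hdeep hxe hdeepe
    f F D hF hD hsupp
  have hk : k ≤ P.m + P.K := hkK.trans (Nat.le_add_left _ _)
  obtain ⟨hθ0, -, hH, h1, hT, h2, -⟩ := HK P hPd hPL hd2 k hk1 hk e he he1 hsm v hv
  exact G P hPd hPL k hk1 hkK hbig c M0 hM0 hfit0 hN0 s W hs R R₀ R₁ hR hR₁ hR10 hLR₀ hW hgap (actualBgU1 hd2 k e v) _ hθ0 hH h1 _ hT h2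
    x μ hx hdeep hxe hdeepe f F D hF hD hsupp

/-! ## §2 The Hölder member of order `θ′ ≤ 1` of (2.30) at the actual background -/

set_option maxHeartbeats 400000 in
/-- **THE HÖLDER MEMBER OF ORDER `θ′ ≤ 1` OF (2.30) FOR `G_{k,loc}(u_k)` AT THE ACTUAL BACKGROUND `u_k` UNDER (7.3.1), GENERIC LIPSCHITZ
CUT-OFF, ALONG EVERY ADMISSIBLE CONTOUR** (p. 263: *"… Hölder derivatives of G_{k,loc}(u) of order less than two"*):
`holder230_smallPlaquette_op_of_lipschitz` at `u = actualBgU1 hd2 k e v`.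
[cite: BalabanImbrieJaffe1988, (2.30) p.263] [cite: BalabanImbrieJaffe1985, (7.3.1) p.326, (4.5.4) p.313] -/
theorem holder230_actualBg_of_lipschitz (d L : ℕ) (hd1 : 1 ≤ d) (hd3 : d + 1 ≤ 3) (hL : Odd L ∧ 1 < L) {a : ℝ} (ha : 0 < a)
    (pexp : ℝ) {K₁ : ℝ} (hK₁ : 0 ≤ K₁) :
    ∃ K t₀ C : ℝ, 1 ≤ K ∧ 0 < t₀ ∧ 0 < C ∧ ∀ (P : Params) (hPd : P.d = d + 1), P.L = L →
      ∀ (hd2 : 2 ≤ P.d) (k : ℕ), 1 ≤ k → k ≤ P.K → 2 * (P.L ^ k - 1) + 4 < P.sitesPerDir 0 →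
      ∀ (e : ℝ), 0 < e → e ≤ 1 → e * (1 + Real.log e⁻¹) ^ pexp ≤ 1 / (23 * (P.d : ℝ) ^ 2 * K) →
      ∀ (v : U1Field P k), (∀ q : Balaban1983to89.Plaq P k, ‖((plaq v q : Circle) : ℂ) - 1‖ ≤ e * (1 + Real.log e⁻¹) ^ pexp) →
      ∀ (c M0 : Fin (d + 1) → ℕ), (∀ i, 1 ≤ M0 i) →
        (∀ i, c i * P.L ^ k + P.L ^ k * M0 i ≤ P.sitesPerDir 0) → (∀ i, P.L ^ k * M0 i < P.sitesPerDir 0) →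
      ∀ (s W : ℕ), 1 ≤ s → ∀ (R R₀ R₁ : ℝ), (P.L : ℝ) ^ k + 1 ≤ R → 0 ≤ R₁ → R₁ < R₀ → (P.L : ℝ) ^ k ≤ R₀ →
        2 * (s : ℝ) / 3 + R₀ / 2 + R ≤ W → (∀ i, ((P.L ^ k * M0 i : ℕ) : ℝ) + R ≤ P.sitesPerDir 0) →
      ∀ (ζ : Balaban1983to89.Site P 0 → Balaban1983to89.Site P 0 → ℝ), (∀ x y, |ζ x y| ≤ 1) →
        (∀ x y, R₀ ≤ B5Ineq137Torus.T P 0 x y → ζ x y = 0) →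
        (∀ (x y : Balaban1983to89.Site P 0) (ν : Fin P.d), |ζ (x.shift ν) y - ζ x y| ≤ K₁ / (R₀ - R₁)) →
      ∀ (θ' : ℝ), 0 ≤ θ' → θ' ≤ 1 →
      ∀ (x₁ x₂ : Balaban1983to89.Site P 0) (n : ℕ) (sq : ℕ → Balaban1983to89.Site P 0) (cb : ℕ → PBond P 0),
        sq 0 = x₁ → sq n = x₂ → (∀ m < n, Joins (cb m) (sq m) (sq (m + 1))) →
        (n : ℝ) ≤ ((d : ℝ) + 1) * B5Ineq137Torus.T P 0 x₁ x₂ →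
        (∀ m ≤ n, sq m ∈ (cubeT hPd (P.L ^ k) c fun i => P.L ^ k * M0 i) ∧
          (∀ i, R₀ ≤ (boxCoord hPd (P.L ^ k) c (sq m) i : ℝ) ∧ (boxCoord hPd (P.L ^ k) c (sq m) i : ℝ) + R₀ ≤ (P.L ^ k * M0 i : ℕ) - 1) ∧
          B5Ineq137Torus.T P 0 x₁ (sq m) ≤ B5Ineq137Torus.T P 0 x₁ x₂) →
      ∀ (f : Balaban1983to89.Site P 0 → ℂ) (F D : ℝ), (∀ y, ‖f y‖ ≤ F) → 0 ≤ D →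
        (∀ y, f y ≠ 0 → D ≤ B5Ineq137Torus.T P 0 x₁ y) → (∀ y, f y ≠ 0 → D ≤ B5Ineq137Torus.T P 0 x₂ y) →
        ((P.L : ℝ) ^ k / B5Ineq137Torus.T P 0 x₁ x₂) ^ θ' *
          ‖toC (chainHol sq cb (actualBgU1 hd2 k e v) n) *
              (gLocT (B1RG242Torus.α P a k * (P.L : ℝ) ^ (k * P.d)) P.eps⁻¹ (actualBgU1 hd2 k e v) k (cubeFam hPd (P.L ^ k) c M0 s W)
                (lamFam hPd (P.L ^ k) c M0 s) ζ *ᵥ f) x₂ -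
            (gLocT (B1RG242Torus.α P a k * (P.L : ℝ) ^ (k * P.d)) P.eps⁻¹ (actualBgU1 hd2 k e v) k (cubeFam hPd (P.L ^ k) c M0 s W)
                (lamFam hPd (P.L ^ k) c M0 s) ζ *ᵥ f) x₁‖ ≤
          P.spacing k ^ 2 * (C * (⌊(((P.L : ℝ) ^ k) - 1 + R₀) / s⌋₊ + 3) ^ (d + 1) *
            (1 + (P.L : ℝ) ^ k * ((R₀ - R₁)⁻¹ + (s : ℝ)⁻¹)) * Real.exp (-(t₀ * (((P.L : ℝ) ^ k)⁻¹ * D))) * F) := by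
  obtain ⟨K, hK1, HK⟩ := smallPlaquette_actualBg (d := d + 1) (L := L) (by omega) pexp
  obtain ⟨t₀, C, ht₀, hC, G⟩ := holder230_smallPlaquette_op_of_lipschitz d L hd1 hd3 hL ha hK₁
  refine ⟨K, t₀, C, hK1, ht₀, hC, ?_⟩
  intro P hPd hPL hd2 k hk1 hkK hbig e he he1 hsm v hv c M0 hM0 hfit0 hN0 s W hs R R₀ R₁ hR hR₁ hR10 hLR₀ hW hgap ζ hζabs hζ0 hζ1
    θ' hθ'0 hθ'1 x₁ x₂ n sq cb hsq0 hsqn hJ hnle hchain f F D hF hD hsupp₁ hsupp₂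
  have hk : k ≤ P.m + P.K := hkK.trans (Nat.le_add_left _ _)
  obtain ⟨hθ0, -, hH, h1, hT, h2, -⟩ := HK P hPd hPL hd2 k hk1 hk e he he1 hsm v hv
  exact G P hPd hPL k hk1 hkK hbig c M0 hM0 hfit0 hN0 s W hs R R₀ R₁ hR hR₁ hR10 hLR₀ hW hgap ζ hζabs hζ0 hζ1 (actualBgU1 hd2 k e v) _ hθ0
    hH h1 _ hT h2 θ' hθ'0 hθ'1 x₁ x₂ n sq cb hsq0 hsqn hJ hnle hchain f F D hF hD hsupp₁ hsupp₂

/-- **THE HÖLDER MEMBER OF ORDER `θ′ ≤ 1` OF (2.30) AT THE ACTUAL BACKGROUND, p13's CUT-OFF OF RECORD, ALONG A SHORTEST CONTOUR** ([6]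
(1.9)'s ∃-form for pairs at chart depth `≥ R₀` with `|x₁ − x₂|_T ≤ R₀`): `exists_contour_holder230_smallPlaquette_op_cwt` at
`u = actualBgU1 hd2 k e v`. [cite: BalabanImbrieJaffe1988, (2.30) p.263] [cite: BalabanImbrieJaffe1985, (7.3.1) p.326, (4.5.4) p.313] -/
theorem exists_contour_holder230_actualBg (d L : ℕ) (hd1 : 1 ≤ d) (hd3 : d + 1 ≤ 3) (hL : Odd L ∧ 1 < L) {a : ℝ} (ha : 0 < a)
    (pexp : ℝ) :
    ∃ K t₀ C : ℝ, 1 ≤ K ∧ 0 < t₀ ∧ 0 < C ∧ ∀ (P : Params) (hPd : P.d = d + 1), P.L = L →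
      ∀ (hd2 : 2 ≤ P.d) (k : ℕ), 1 ≤ k → k ≤ P.K → 2 * (P.L ^ k - 1) + 4 < P.sitesPerDir 0 →
      ∀ (e : ℝ), 0 < e → e ≤ 1 → e * (1 + Real.log e⁻¹) ^ pexp ≤ 1 / (23 * (P.d : ℝ) ^ 2 * K) →
      ∀ (v : U1Field P k), (∀ q : Balaban1983to89.Plaq P k, ‖((plaq v q : Circle) : ℂ) - 1‖ ≤ e * (1 + Real.log e⁻¹) ^ pexp) →
      ∀ (c M0 : Fin (d + 1) → ℕ), (∀ i, 1 ≤ M0 i) →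
        (∀ i, c i * P.L ^ k + P.L ^ k * M0 i ≤ P.sitesPerDir 0) → (∀ i, P.L ^ k * M0 i < P.sitesPerDir 0) →
      ∀ (s W : ℕ), 1 ≤ s → ∀ (R R₀ R₁ : ℝ), (P.L : ℝ) ^ k + 1 ≤ R → 0 ≤ R₁ → R₁ < R₀ → (P.L : ℝ) ^ k ≤ R₀ →
        2 * (s : ℝ) / 3 + R₀ / 2 + R ≤ W → (∀ i, ((P.L ^ k * M0 i : ℕ) : ℝ) + R ≤ P.sitesPerDir 0) →
      ∀ (x₁ x₂ : Balaban1983to89.Site P 0),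
        x₁ ∈ (cubeT hPd (P.L ^ k) c fun i => P.L ^ k * M0 i) →
        (∀ i, R₀ ≤ (boxCoord hPd (P.L ^ k) c x₁ i : ℝ) ∧ (boxCoord hPd (P.L ^ k) c x₁ i : ℝ) + R₀ ≤ (P.L ^ k * M0 i : ℕ) - 1) →
        x₂ ∈ (cubeT hPd (P.L ^ k) c fun i => P.L ^ k * M0 i) →
        (∀ i, R₀ ≤ (boxCoord hPd (P.L ^ k) c x₂ i : ℝ) ∧ (boxCoord hPd (P.L ^ k) c x₂ i : ℝ) + R₀ ≤ (P.L ^ k * M0 i : ℕ) - 1) →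
        B5Ineq137Torus.T P 0 x₁ x₂ ≤ R₀ →
      ∃ (N : ℕ) (sq : ℕ → Balaban1983to89.Site P 0) (cb : ℕ → PBond P 0), sq 0 = x₁ ∧ sq N = x₂ ∧
        (∀ m < N, Joins (cb m) (sq m) (sq (m + 1))) ∧ (N : ℝ) ≤ ((d : ℝ) + 1) * B5Ineq137Torus.T P 0 x₁ x₂ ∧
      ∀ (θ' : ℝ), 0 ≤ θ' → θ' ≤ 1 →
      ∀ (f : Balaban1983to89.Site P 0 → ℂ) (F D : ℝ), (∀ y, ‖f y‖ ≤ F) → 0 ≤ D →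
        (∀ y, f y ≠ 0 → D ≤ B5Ineq137Torus.T P 0 x₁ y) → (∀ y, f y ≠ 0 → D ≤ B5Ineq137Torus.T P 0 x₂ y) →
        ((P.L : ℝ) ^ k / B5Ineq137Torus.T P 0 x₁ x₂) ^ θ' *
          ‖toC (chainHol sq cb (actualBgU1 hd2 k e v) N) *
              (gLocT (B1RG242Torus.α P a k * (P.L : ℝ) ^ (k * P.d)) P.eps⁻¹ (actualBgU1 hd2 k e v) k (cubeFam hPd (P.L ^ k) c M0 s W)
                (lamFam hPd (P.L ^ k) c M0 s) (cutoff R₁ R₀ (B5Ineq137Torus.T P 0)) *ᵥ f) x₂ -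
            (gLocT (B1RG242Torus.α P a k * (P.L : ℝ) ^ (k * P.d)) P.eps⁻¹ (actualBgU1 hd2 k e v) k (cubeFam hPd (P.L ^ k) c M0 s W)
                (lamFam hPd (P.L ^ k) c M0 s) (cutoff R₁ R₀ (B5Ineq137Torus.T P 0)) *ᵥ f) x₁‖ ≤
          P.spacing k ^ 2 * (C * (⌊(((P.L : ℝ) ^ k) - 1 + R₀) / s⌋₊ + 3) ^ (d + 1) *
            (1 + (P.L : ℝ) ^ k * ((R₀ - R₁)⁻¹ + (s : ℝ)⁻¹)) * Real.exp (-(t₀ * (((P.L : ℝ) ^ k)⁻¹ * D))) * F) := by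
  obtain ⟨K, hK1, HK⟩ := smallPlaquette_actualBg (d := d + 1) (L := L) (by omega) pexp
  obtain ⟨t₀, C, ht₀, hC, G⟩ := exists_contour_holder230_smallPlaquette_op_cwt d L hd1 hd3 hL ha
  refine ⟨K, t₀, C, hK1, ht₀, hC, ?_⟩
  intro P hPd hPL hd2 k hk1 hkK hbig e he he1 hsm v hv c M0 hM0 hfit0 hN0 s W hs R R₀ R₁ hR hR₁ hR10 hLR₀ hW hgap x₁ x₂ hx₁ hdeep₁ hx₂
    hdeep₂ hT12
  have hk : k ≤ P.m + P.K := hkK.trans (Nat.le_add_left _ _)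
  obtain ⟨hθ0, -, hH, h1, hT, h2, -⟩ := HK P hPd hPL hd2 k hk1 hk e he he1 hsm v hv
  exact G P hPd hPL k hk1 hkK hbig c M0 hM0 hfit0 hN0 s W hs R R₀ R₁ hR hR₁ hR10 hLR₀ hW hgap (actualBgU1 hd2 k e v) _ hθ0 hH h1 _ hT h2
    x₁ x₂ hx₁ hdeep₁ hx₂ hdeep₂ hT12

/-! ## §3 The Hölder member of order `1 + θ` of (2.30) at the actual background -/

set_option maxHeartbeats 400000 in
/-- **THE HÖLDER MEMBER OF ORDER `1 + θ` OF (2.30) FOR `G_{k,loc}(u_k)` AT THE ACTUAL BACKGROUND `u_k` UNDER (7.3.1), GENERIC SMOOTH CUT-OFF**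
(p. 263: *"… Hölder derivatives of G_{k,loc}(u) of order less than two"*; [6] p. 573 (1.9)): `derivHolder230_smallPlaquette_of_smooth` at
`u = actualBgU1 hd2 k e v` (`U(Γ_{x₁,x₂})` = p30's staircase `stairHol`).
[cite: BalabanImbrieJaffe1988, (2.30) p.263] [cite: BalabanImbrieJaffe1985, (7.3.1) p.326, (4.5.4) p.313] [cite: Balaban1983RegularityDecay, Theorem p.573 (1.9)] -/
theorem derivHolder230_actualBg_of_smooth (d L : ℕ) (hd1 : 1 ≤ d) (hd3 : d + 1 ≤ 3) (hL : Odd L ∧ 1 < L) {a : ℝ} (ha : 0 < a)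
    (pexp : ℝ) {θ : ℝ} (hθ0 : 0 ≤ θ) (hθ1 : θ < 1) {K₁ K₂ : ℝ} (hK₁ : 0 ≤ K₁) (hK₂ : 0 ≤ K₂) :
    ∃ K t₀ c₀ : ℝ, 1 ≤ K ∧ 0 < t₀ ∧ 0 < c₀ ∧ ∀ (P : Params) (hPd : P.d = d + 1), P.L = L →
      ∀ (hd2 : 2 ≤ P.d) (k : ℕ), 1 ≤ k → k ≤ P.K → 2 * (P.L ^ k - 1) + 4 < P.sitesPerDir 0 →
      ∀ (e : ℝ), 0 < e → e ≤ 1 → e * (1 + Real.log e⁻¹) ^ pexp ≤ 1 / (23 * (P.d : ℝ) ^ 2 * K) →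
      ∀ (v : U1Field P k), (∀ q : Balaban1983to89.Plaq P k, ‖((plaq v q : Circle) : ℂ) - 1‖ ≤ e * (1 + Real.log e⁻¹) ^ pexp) →
      ∀ (c M0 : Fin (d + 1) → ℕ), (∀ i, 1 ≤ M0 i) →
        (∀ i, c i * P.L ^ k + P.L ^ k * M0 i ≤ P.sitesPerDir 0) → (∀ i, P.L ^ k * M0 i < P.sitesPerDir 0) →
      ∀ (s W : ℕ), 1 ≤ s → ∀ (R R₀ R₁ : ℝ), 4 * (P.L : ℝ) ^ k + 1 < R → 0 ≤ R₁ → R₁ < R₀ → 3 * (P.L : ℝ) ^ k ≤ R₀ →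
        2 * (s : ℝ) / 3 + R₀ / 2 + R ≤ W → (∀ i, ((P.L ^ k * M0 i : ℕ) : ℝ) + R ≤ P.sitesPerDir 0) →
      ∀ (ζ : Balaban1983to89.Site P 0 → Balaban1983to89.Site P 0 → ℝ), (∀ x y, |ζ x y| ≤ 1) →
        (∀ x y, R₀ ≤ B5Ineq137Torus.T P 0 x y → ζ x y = 0) →
        (∀ (x y : Balaban1983to89.Site P 0) (ν : Fin P.d), |ζ (x.shift ν) y - ζ x y| ≤ K₁ / (R₀ - R₁)) →
        (∀ (x y : Balaban1983to89.Site P 0) (κ ν : Fin P.d),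
          |ζ ((x.shift ν).shift κ) y - ζ (x.shift ν) y - ζ (x.shift κ) y + ζ x y| ≤ K₂ / (R₀ - R₁) ^ 2) →
      ∀ (x₁ x₂ : Balaban1983to89.Site P 0) (μ : Fin P.d),
        x₁ ∈ (cubeT hPd (P.L ^ k) c fun i => P.L ^ k * M0 i) →
        (∀ i, R₀ ≤ (boxCoord hPd (P.L ^ k) c x₁ i : ℝ) ∧ (boxCoord hPd (P.L ^ k) c x₁ i : ℝ) + R₀ ≤ (P.L ^ k * M0 i : ℕ) - 1) →
        x₁.shift μ ∈ (cubeT hPd (P.L ^ k) c fun i => P.L ^ k * M0 i) →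
        (∀ i, R₀ ≤ (boxCoord hPd (P.L ^ k) c (x₁.shift μ) i : ℝ) ∧
          (boxCoord hPd (P.L ^ k) c (x₁.shift μ) i : ℝ) + R₀ ≤ (P.L ^ k * M0 i : ℕ) - 1) →
        x₂ ∈ (cubeT hPd (P.L ^ k) c fun i => P.L ^ k * M0 i) →
        (∀ i, R₀ ≤ (boxCoord hPd (P.L ^ k) c x₂ i : ℝ) ∧ (boxCoord hPd (P.L ^ k) c x₂ i : ℝ) + R₀ ≤ (P.L ^ k * M0 i : ℕ) - 1) →
        x₂.shift μ ∈ (cubeT hPd (P.L ^ k) c fun i => P.L ^ k * M0 i) →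
        (∀ i, R₀ ≤ (boxCoord hPd (P.L ^ k) c (x₂.shift μ) i : ℝ) ∧
          (boxCoord hPd (P.L ^ k) c (x₂.shift μ) i : ℝ) + R₀ ≤ (P.L ^ k * M0 i : ℕ) - 1) →
      ∀ (f : Balaban1983to89.Site P 0 → ℂ) (F D : ℝ), (∀ y, ‖f y‖ ≤ F) → 0 ≤ D →
        (∀ y, f y ≠ 0 → D ≤ B5Ineq137Torus.T P 0 x₁ y) → (∀ y, f y ≠ 0 → D ≤ B5Ineq137Torus.T P 0 x₂ y) →
        ((P.L : ℝ) ^ k / B5Ineq137Torus.T P 0 x₁ x₂) ^ θ *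
          ‖stairHol (actualBgU1 hd2 k e v) x₁ x₂ *
              covD P.eps⁻¹ (cfg (actualBgU1 hd2 k e v))
                (gLocT (B1RG242Torus.α P a k * (P.L : ℝ) ^ (k * P.d)) P.eps⁻¹ (actualBgU1 hd2 k e v) k
                  (cubeFam hPd (P.L ^ k) c M0 s W) (lamFam hPd (P.L ^ k) c M0 s) ζ *ᵥ f) ⟨x₂, μ⟩ -
            covD P.eps⁻¹ (cfg (actualBgU1 hd2 k e v))
                (gLocT (B1RG242Torus.α P a k * (P.L : ℝ) ^ (k * P.d)) P.eps⁻¹ (actualBgU1 hd2 k e v) k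
                  (cubeFam hPd (P.L ^ k) c M0 s W) (lamFam hPd (P.L ^ k) c M0 s) ζ *ᵥ f) ⟨x₁, μ⟩‖ ≤
          P.spacing k * (c₀ * (⌊(((P.L : ℝ) ^ k) - 1 + R₀) / s⌋₊ + 3) ^ (d + 1) *
            (1 + (P.L : ℝ) ^ k * ((R₀ - R₁)⁻¹ + (s : ℝ)⁻¹)) ^ 2 * Real.exp (-(t₀ * (((P.L : ℝ) ^ k)⁻¹ * D))) * F) := by
  obtain ⟨K, hK1, HK⟩ := smallPlaquette_actualBg (d := d + 1) (L := L) (by omega) pexp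
  obtain ⟨t₀, c₀, ht₀, hc₀, G⟩ := derivHolder230_smallPlaquette_of_smooth d L hd1 hd3 hL ha hθ0 hθ1 hK₁ hK₂
  refine ⟨K, t₀, c₀, hK1, ht₀, hc₀, ?_⟩
  intro P hPd hPL hd2 k hk1 hkK hbig e he he1 hsm v hv c M0 hM0 hfit0 hN0 s W hs R R₀ R₁ hR hR₁ hR10 hLR₀ hW hgap ζ hζabs hζ0 hζ1 hζ2
    x₁ x₂ μ hx₁ hdeep₁ hx₁e hdeep₁e hx₂ hdeep₂ hx₂e hdeep₂e f F D hF hD hsupp₁ hsupp₂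
  have hk : k ≤ P.m + P.K := hkK.trans (Nat.le_add_left _ _)
  obtain ⟨hθp0, -, hH, h1, hT, h2, -⟩ := HK P hPd hPL hd2 k hk1 hk e he he1 hsm v hv
  exact G P hPd hPL k hk1 hkK hbig c M0 hM0 hfit0 hN0 s W hs R R₀ R₁ hR hR₁ hR10 hLR₀ hW hgap ζ hζabs hζ0 hζ1 hζ2 (actualBgU1 hd2 k e v) _
    hθp0 hH h1 _ hT h2 x₁ x₂ μ hx₁ hdeep₁ hx₁e hdeep₁e hx₂ hdeep₂ hx₂e hdeep₂e f F D hF hD hsupp₁ hsupp₂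

set_option maxHeartbeats 400000 in
/-- **THE HÖLDER MEMBER OF ORDER `1 + θ` OF (2.30) AT THE ACTUAL BACKGROUND FOR THE SMOOTH PRODUCT CUT-OFF `ζ″ = ζ^Π(R₁, R₀)`** (print p. 263:
*"ζ_k(x₁, x₂) is a smooth function of x₁ − x₂"*): `derivHolder230_smallPlaquette_zetaPi` at `u = actualBgU1 hd2 k e v`.
[cite: BalabanImbrieJaffe1988, (2.30) p.263] [cite: BalabanImbrieJaffe1985, (7.3.1) p.326, (4.5.4) p.313] [cite: Balaban1983RegularityDecay, Theorem p.573 (1.9)] -/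
theorem derivHolder230_actualBg_zetaPi (d L : ℕ) (hd1 : 1 ≤ d) (hd3 : d + 1 ≤ 3) (hL : Odd L ∧ 1 < L) {a : ℝ} (ha : 0 < a)
    (pexp : ℝ) {θ : ℝ} (hθ0 : 0 ≤ θ) (hθ1 : θ < 1) :
    ∃ K t₀ c₀ : ℝ, 1 ≤ K ∧ 0 < t₀ ∧ 0 < c₀ ∧ ∀ (P : Params) (hPd : P.d = d + 1), P.L = L →
      ∀ (hd2 : 2 ≤ P.d) (k : ℕ), 1 ≤ k → k ≤ P.K → 2 * (P.L ^ k - 1) + 4 < P.sitesPerDir 0 →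
      ∀ (e : ℝ), 0 < e → e ≤ 1 → e * (1 + Real.log e⁻¹) ^ pexp ≤ 1 / (23 * (P.d : ℝ) ^ 2 * K) →
      ∀ (v : U1Field P k), (∀ q : Balaban1983to89.Plaq P k, ‖((plaq v q : Circle) : ℂ) - 1‖ ≤ e * (1 + Real.log e⁻¹) ^ pexp) →
      ∀ (c M0 : Fin (d + 1) → ℕ), (∀ i, 1 ≤ M0 i) →
        (∀ i, c i * P.L ^ k + P.L ^ k * M0 i ≤ P.sitesPerDir 0) → (∀ i, P.L ^ k * M0 i < P.sitesPerDir 0) →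
      ∀ (s W : ℕ), 1 ≤ s → ∀ (R R₀ R₁ : ℝ), 4 * (P.L : ℝ) ^ k + 1 < R → 1 ≤ R₁ → R₁ < R₀ → R₀ ≤ ((P.sitesPerDir 0 : ℝ) - 3) / 2 →
        3 * (P.L : ℝ) ^ k ≤ R₀ → 2 * (s : ℝ) / 3 + R₀ / 2 + R ≤ W → (∀ i, ((P.L ^ k * M0 i : ℕ) : ℝ) + R ≤ P.sitesPerDir 0) →
      ∀ (x₁ x₂ : Balaban1983to89.Site P 0) (μ : Fin P.d),
        x₁ ∈ (cubeT hPd (P.L ^ k) c fun i => P.L ^ k * M0 i) →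
        (∀ i, R₀ ≤ (boxCoord hPd (P.L ^ k) c x₁ i : ℝ) ∧ (boxCoord hPd (P.L ^ k) c x₁ i : ℝ) + R₀ ≤ (P.L ^ k * M0 i : ℕ) - 1) →
        x₁.shift μ ∈ (cubeT hPd (P.L ^ k) c fun i => P.L ^ k * M0 i) →
        (∀ i, R₀ ≤ (boxCoord hPd (P.L ^ k) c (x₁.shift μ) i : ℝ) ∧
          (boxCoord hPd (P.L ^ k) c (x₁.shift μ) i : ℝ) + R₀ ≤ (P.L ^ k * M0 i : ℕ) - 1) →
        x₂ ∈ (cubeT hPd (P.L ^ k) c fun i => P.L ^ k * M0 i) →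
        (∀ i, R₀ ≤ (boxCoord hPd (P.L ^ k) c x₂ i : ℝ) ∧ (boxCoord hPd (P.L ^ k) c x₂ i : ℝ) + R₀ ≤ (P.L ^ k * M0 i : ℕ) - 1) →
        x₂.shift μ ∈ (cubeT hPd (P.L ^ k) c fun i => P.L ^ k * M0 i) →
        (∀ i, R₀ ≤ (boxCoord hPd (P.L ^ k) c (x₂.shift μ) i : ℝ) ∧
          (boxCoord hPd (P.L ^ k) c (x₂.shift μ) i : ℝ) + R₀ ≤ (P.L ^ k * M0 i : ℕ) - 1) →
      ∀ (f : Balaban1983to89.Site P 0 → ℂ) (F D : ℝ), (∀ y, ‖f y‖ ≤ F) → 0 ≤ D →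
        (∀ y, f y ≠ 0 → D ≤ B5Ineq137Torus.T P 0 x₁ y) → (∀ y, f y ≠ 0 → D ≤ B5Ineq137Torus.T P 0 x₂ y) →
        ((P.L : ℝ) ^ k / B5Ineq137Torus.T P 0 x₁ x₂) ^ θ *
          ‖stairHol (actualBgU1 hd2 k e v) x₁ x₂ *
              covD P.eps⁻¹ (cfg (actualBgU1 hd2 k e v))
                (gLocT (B1RG242Torus.α P a k * (P.L : ℝ) ^ (k * P.d)) P.eps⁻¹ (actualBgU1 hd2 k e v) k
                  (cubeFam hPd (P.L ^ k) c M0 s W) (lamFam hPd (P.L ^ k) c M0 s) (zetaPi R₁ R₀ 0) *ᵥ f) ⟨x₂, μ⟩ -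
            covD P.eps⁻¹ (cfg (actualBgU1 hd2 k e v))
                (gLocT (B1RG242Torus.α P a k * (P.L : ℝ) ^ (k * P.d)) P.eps⁻¹ (actualBgU1 hd2 k e v) k
                  (cubeFam hPd (P.L ^ k) c M0 s W) (lamFam hPd (P.L ^ k) c M0 s) (zetaPi R₁ R₀ 0) *ᵥ f) ⟨x₁, μ⟩‖ ≤
          P.spacing k * (c₀ * (⌊(((P.L : ℝ) ^ k) - 1 + R₀) / s⌋₊ + 3) ^ (d + 1) *
            (1 + (P.L : ℝ) ^ k * ((R₀ - R₁)⁻¹ + (s : ℝ)⁻¹)) ^ 2 * Real.exp (-(t₀ * (((P.L : ℝ) ^ k)⁻¹ * D))) * F) := by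
  obtain ⟨K, hK1, HK⟩ := smallPlaquette_actualBg (d := d + 1) (L := L) (by omega) pexp
  obtain ⟨t₀, c₀, ht₀, hc₀, G⟩ := derivHolder230_smallPlaquette_zetaPi d L hd1 hd3 hL ha hθ0 hθ1
  refine ⟨K, t₀, c₀, hK1, ht₀, hc₀, ?_⟩
  intro P hPd hPL hd2 k hk1 hkK hbig e he he1 hsm v hv c M0 hM0 hfit0 hN0 s W hs R R₀ R₁ hR hR₁ hR10 hR₀N hLR₀ hW hgap
    x₁ x₂ μ hx₁ hdeep₁ hx₁e hdeep₁e hx₂ hdeep₂ hx₂e hdeep₂e f F D hF hD hsupp₁ hsupp₂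
  have hk : k ≤ P.m + P.K := hkK.trans (Nat.le_add_left _ _)
  obtain ⟨hθp0, -, hH, h1, hT, h2, -⟩ := HK P hPd hPL hd2 k hk1 hk e he he1 hsm v hv
  exact G P hPd hPL k hk1 hkK hbig c M0 hM0 hfit0 hN0 s W hs R R₀ R₁ hR hR₁ hR10 hR₀N hLR₀ hW hgap (actualBgU1 hd2 k e v) _ hθp0 hH h1 _
    hT h2 x₁ x₂ μ hx₁ hdeep₁ hx₁e hdeep₁e hx₂ hdeep₂ hx₂e hdeep₂e f F D hF hD hsupp₁ hsupp₂

end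

end Literature.MathematicalPhysics.QuantumFieldTheory.BalabanImbrieJaffe1984to88.BIJ88Loc230ActualBackground
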